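import Summits.QuantumFields.YangMills.Theorems.LuscherReductionTwistedTraceScalingLatticeGnChart
import Summits.QuantumFields.YangMills.Theorems.LuscherReductionTwistedTraceScalingTangentChart
import HarnessLib

/-!
# The one-link kinetic exponent in GNOMONIC coordinates: `2|y−y'|²/((1+|y|²)(1+|y'|²)) ≤ ‖P(1,y) − P(1,y')‖_F² ≤ 2|y−y'|²`
# (radial projection is 1-Lipschitz outside the unit ball; Lagrange's identity) — so in the chart of `…LatticeGnChart` the kinetic factor
# `w_β = e^{2β}e^{−(β/2)‖U−V‖_F²}` is sandwiched by Gaussians `e^{−β|y−y'|²} ≤ · ≤ e^{−β|y−y'|²/((1+ρ²)²)}` on `|y|,|y'| ≤ ρ`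
# (lane B of S-BASE, crux `TwistedTraceScaling` stmt-QuantumFields-20203; the Laplace step of both COARSE lanes)

HONEST FRAMING: elementary algebra of the gnomonic chart of one link; femto rung R2b1 (stub of a child of a CONDITIONAL route); not a gap, not Clay.
-/

set_option autoImplicit false

noncomputable section

open scoped BigOperators
open Literature.MathematicalPhysics.QuantumFieldTheory
open Literature.MathematicalPhysics.QuantumLattice
open Literature.MathematicalPhysics.QuantumFieldTheory.Balaban1983to89.T4CubeChartGnomonic (gnoPoint)

namespace Summit.QuantumFields.YangMills.Theorems.FemtoTransferGap.TwoLattice.GnChart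

open Summit.QuantumFields.YangMills.Theorems.FemtoTransferGap

/-- The chart data of `P(1,y)`: `s = scalarPart > 0`, `s²(1+|y|²) = 1`, `v_a = s·y_a`. [folklore] -/
theorem gnoPoint_chart (y : Fin 3 → ℝ) :
    0 < scalarPart (gnoPoint y) ∧ scalarPart (gnoPoint y) ^ 2 * (1 + ∑ a, y a ^ 2) = 1 ∧
      ∀ a, vecPart (gnoPoint y) a = scalarPart (gnoPoint y) * y a := by
  have hN := sq_norm_gnomonicQuat y
  have hNpos := norm_gnomonicQuat_pos y
  refine ⟨scalarPart_gnoPoint_pos y, ?_, fun a => ?_⟩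
  · rw [scalarPart_gnoPoint, inv_pow, hN.symm, inv_mul_cancel₀ (pow_pos hNpos 2).ne']
  · rw [vecPart_gnoPoint, scalarPart_gnoPoint]

/-- The real-variable core of the two-sided bound: with `s²A = t²B = 1`, `A, B ≥ 1`, `D = A + B − 2c ≤ AB − c²`:
`2D ≤ AB·2(2 − 2stc)` and `2(2 − 2stc) ≤ 2D`. [folklore] -/
theorem kinetic_core {s t A B c D : ℝ} (hs : 0 < s) (ht : 0 < t) (hsA : s ^ 2 * A = 1) (htB : t ^ 2 * B = 1) (hA1 : 1 ≤ A)
    (hB1 : 1 ≤ B) (hD : D = A + B - 2 * c) (hD0 : 0 ≤ D) (hlag : D ≤ A * B - c ^ 2) :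
    2 * D ≤ A * B * (2 * (2 - 2 * (s * t) * c)) ∧ 2 * (2 - 2 * (s * t) * c) ≤ 2 * D := by
  have hA : 0 < A := by linarith
  have hB : 0 < B := by linarith
  have hs1 : s ≤ 1 := by nlinarith
  have ht1 : t ≤ 1 := by nlinarith
  set P := s * t with hP
  have hP0 : 0 < P := mul_pos hs ht
  have hP1 : P ≤ 1 := by rw [hP]; nlinarith
  have hPAB : P ^ 2 * (A * B) = 1 := by
    calc P ^ 2 * (A * B) = (s ^ 2 * A) * (t ^ 2 * B) := by rw [hP]; ring
      _ = 1 := by rw [hsA, htB, one_mul]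
  -- Cauchy–Schwarz `P c ≤ 1`
  have hc2 : c ^ 2 ≤ A * B := by linarith
  have hPc : P * c ≤ 1 := by
    have h1 : (P * c) ^ 2 ≤ 1 := by
      calc (P * c) ^ 2 = P ^ 2 * c ^ 2 := by ring
        _ ≤ P ^ 2 * (A * B) := mul_le_mul_of_nonneg_left hc2 (sq_nonneg _)
        _ = 1 := hPAB
    nlinarith [sq_nonneg (P * c - 1), sq_nonneg (P * c + 1)]
  constructor
  · -- lower: `AB − c² ≤ 2AB(1 − Pc)` since `c² = AB (Pc)²`
    have hc2' : c ^ 2 = A * B * (P * c) ^ 2 := by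
      calc c ^ 2 = c ^ 2 * (P ^ 2 * (A * B)) := by rw [hPAB, mul_one]
        _ = A * B * (P * c) ^ 2 := by ring
    have hX : 0 ≤ A * B * (1 - P * c) ^ 2 := mul_nonneg (mul_pos hA hB).le (sq_nonneg _)
    have h3 : A * B - c ^ 2 ≤ 2 * (A * B) * (1 - P * c) := by nlinarith [hX, hc2']
    nlinarith [hlag, h3]
  · -- upper: `2 − 2Pc ≤ A + B − 2c`; multiply by `s²t²`
    rw [hD]
    have hst2 : 0 < s ^ 2 * t ^ 2 := by positivity
    -- `s²t²(A + B − 2c) = t² + s² − 2 s²t² c`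
    have e1 : s ^ 2 * t ^ 2 * (A + B - 2 * c) = t ^ 2 + s ^ 2 - 2 * (s ^ 2 * t ^ 2) * c := by
      calc s ^ 2 * t ^ 2 * (A + B - 2 * c) = t ^ 2 * (s ^ 2 * A) + s ^ 2 * (t ^ 2 * B) - 2 * (s ^ 2 * t ^ 2) * c := by ring
        _ = t ^ 2 + s ^ 2 - 2 * (s ^ 2 * t ^ 2) * c := by rw [hsA, htB]; ring
    -- it suffices: `s²t²(2 − 2Pc) ≤ s²t²(A+B−2c)`
    suffices h : s ^ 2 * t ^ 2 * (2 - 2 * P * c) ≤ s ^ 2 * t ^ 2 * (A + B - 2 * c) by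
      have := le_of_mul_le_mul_left (by linarith [h] : s ^ 2 * t ^ 2 * (2 - 2 * P * c) ≤ s ^ 2 * t ^ 2 * (A + B - 2 * c)) hst2
      linarith
    rw [e1]
    have hP2 : s ^ 2 * t ^ 2 = P ^ 2 := by rw [hP]; ring
    rw [hP2]
    -- `2P² − 2P³c ≤ s² + t² − 2P²c`, i.e. `2P²c(1 − P) ≤ s² + t² − 2P²`; and `s² + t² − 2P = (s−t)² ≥ 0`
    have hsq : 2 * P ≤ s ^ 2 + t ^ 2 := by rw [hP]; nlinarith [sq_nonneg (s - t)]
    rcases le_or_gt c 0 with hc | hc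
    · nlinarith [mul_nonneg (mul_nonneg (sq_nonneg P) (by linarith : 0 ≤ 1 - P)) (by linarith : 0 ≤ -c)]
    · have h1 : P ^ 2 * c * (1 - P) ≤ P * (1 - P) := by
        have := mul_le_mul_of_nonneg_right hPc (mul_nonneg hP0.le (by linarith : 0 ≤ 1 - P))
        nlinarith
      nlinarith

/-- ★ **The one-link kinetic exponent in gnomonic coordinates, two-sided**:
`2|y−y'|² ≤ (1+|y|²)(1+|y'|²)·‖P(1,y) − P(1,y')‖_F²` and `‖P(1,y) − P(1,y')‖_F² ≤ 2|y − y'|²`. [folklore] -/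
theorem frobNorm_gnoPoint_sub_sq_sandwich (y y' : Fin 3 → ℝ) :
    2 * ∑ a, (y a - y' a) ^ 2 ≤ (1 + ∑ a, y a ^ 2) * (1 + ∑ a, y' a ^ 2) *
        frobNorm ((gnoPoint y : Matrix (Fin 2) (Fin 2) ℂ) - (gnoPoint y' : Matrix (Fin 2) (Fin 2) ℂ)) ^ 2 ∧
      frobNorm ((gnoPoint y : Matrix (Fin 2) (Fin 2) ℂ) - (gnoPoint y' : Matrix (Fin 2) (Fin 2) ℂ)) ^ 2 ≤ 2 * ∑ a, (y a - y' a) ^ 2 := by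
  obtain ⟨hs, hsA, hv⟩ := gnoPoint_chart y
  obtain ⟨ht, htB, hv'⟩ := gnoPoint_chart y'
  rw [Chart.frobNorm_sub_sq_eq]
  simp only [hv, hv', Fin.sum_univ_three] at hsA htB ⊢
  generalize scalarPart (gnoPoint y) = s at *
  generalize scalarPart (gnoPoint y') = t at *
  generalize y 0 = a₀ at *
  generalize y 1 = a₁ at *
  generalize y 2 = a₂ at *
  generalize y' 0 = b₀ at *
  generalize y' 1 = b₁ at *
  generalize y' 2 = b₂ at *
  have hexp : (s - t) ^ 2 + ((s * a₀ - t * b₀) ^ 2 + (s * a₁ - t * b₁) ^ 2 + (s * a₂ - t * b₂) ^ 2) =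
      2 - 2 * (s * t) * (1 + (a₀ * b₀ + a₁ * b₁ + a₂ * b₂)) := by
    have e : (s - t) ^ 2 + ((s * a₀ - t * b₀) ^ 2 + (s * a₁ - t * b₁) ^ 2 + (s * a₂ - t * b₂) ^ 2) =
        s ^ 2 * (1 + (a₀ ^ 2 + a₁ ^ 2 + a₂ ^ 2)) + t ^ 2 * (1 + (b₀ ^ 2 + b₁ ^ 2 + b₂ ^ 2)) -
          2 * (s * t) * (1 + (a₀ * b₀ + a₁ * b₁ + a₂ * b₂)) := by ring
    rw [e, hsA, htB]; ring
  rw [hexp]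
  have hlag : (a₀ - b₀) ^ 2 + (a₁ - b₁) ^ 2 + (a₂ - b₂) ^ 2 ≤
      (1 + (a₀ ^ 2 + a₁ ^ 2 + a₂ ^ 2)) * (1 + (b₀ ^ 2 + b₁ ^ 2 + b₂ ^ 2)) - (1 + (a₀ * b₀ + a₁ * b₁ + a₂ * b₂)) ^ 2 := by
    nlinarith [sq_nonneg (a₀ * b₁ - a₁ * b₀), sq_nonneg (a₀ * b₂ - a₂ * b₀), sq_nonneg (a₁ * b₂ - a₂ * b₁)]
  exact kinetic_core hs ht hsA htB (by nlinarith [sq_nonneg a₀, sq_nonneg a₁, sq_nonneg a₂])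
    (by nlinarith [sq_nonneg b₀, sq_nonneg b₁, sq_nonneg b₂]) (by ring) (by positivity) hlag

end Summit.QuantumFields.YangMills.Theorems.FemtoTransferGap.TwoLattice.GnChart

end
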